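import Literature.AnabelianGeometry.SemiGraphs.TemperoidsGaloisObjectsProofs
import Literature.AnabelianGeometry.EtaleTheta.BiKummerOfModelCanonical

/-!
# [EtTh] Def. 4.1 (ii) at the genuine temperoid `B^temp(Π)`: the canonical Galois surjections
# `Π ↠ Aut(A)` and their NATURALITY UP TO INNER AUTOMORPHISM (model of the law of `Sec4GaloisSurjNatural`)

S. Mochizuki, *The étale theta function …*, Publ. RIMS **45** (2009) [MochizukiEtTh2009], §4, Def. 4.1 (ii),
PDF p. 87 (printed p. 313): "the natural surjective outer homomorphism `Π^tp_X ↠ Aut_D(A^bs)`" for a Galois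
object `A^bs` of `D = B^temp(Π^tp_X)⁰[𝒟]`; S. Mochizuki, *Semi-graphs of anabelioids*, Publ. RIMS **42** (2006)
[MochizukiSemiAnbd2006], Remark 3.1.3 p. 34 (Galois objects of `B^temp(Π)` are the `Π/N`, `N` open normal; the
automorphisms of `Π/N` are the right translations).

abc-iut cell, layer L2, ROW «galoisSurj NATURALITY cluster at the canonical model» (abc-iut-L2-lead,
2026-08-26T02:54:52Z; seat abc-iut-w5-d013 gen 2), file (B) = the MODEL companion of
`EtaleTheta/Discharge/Sec4GaloisSurjNatural.lean`: abc-iut-L2-t9's `BiKummerSetting.mkOfModelCanonical` keeps the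
Galois data `(IsGaloisObj, galoisSurj)` as FREE PARAMETERS ("canonical only once `D` is `B^temp(Π^tp_X)⁰`
concretely"), so the naturality law of Def. 4.1 (ii) has content only at the genuine temperoid.  Over
abc-iut-L3-t2's `BTemp Π` (`TemperedGroups.lean`) and the L3 proofs `GaloisObjects.*`
(`TemperoidsGaloisObjectsProofs.lean`: `exists_iso_quotientObj_of_isGaloisObj`, `exists_aut_quotientObj`), for a
tempered `Π` this file CONSTRUCTS and PROVES:

* `quotientTranslation N c ∈ Aut(Π/N)` — the right translation `xN ↦ xcN` (`N` open normal), with its action on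
  points (`quotientTranslation_apply`); `quotientGaloisSurj N : Π →* Aut(Π/N)`, `g ↦ (xN ↦ x g⁻¹ N)` — the
  CANONICAL surjection (a homomorphism for the composition law of `Aut`);
* for a Galois object `A`: a chosen presentation `A ≅ Π/N_A` (`galoisQuot`, `galoisIso`), its base point
  `galoisBase A`, and **`galoisSurjOf A : Π →* Aut A`** (transport of the canonical surjection), characterised
  by `galoisSurjOf_apply_base : galoisSurjOf A g (x_A) = g⁻¹ · x_A`, hence `galoisSurjOf_apply`;
* `galoisSurjOf_surjective` (Def. 4.1 (ii) "surjective"), `mem_ker_galoisSurjOf_iff` / `isOpen_ker_galoisSurjOf`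
  (the kernel is the open stabiliser of the base point);
* **`galoisSurjOf_natural`** — the NATURALITY LAW OF `Sec4GaloisSurjNatural` HOLDS at the temperoid, in EXACTLY
  the binder/field shape used there: for every morphism `b : B → A` between Galois objects there is `c ∈ Π`
  with `b ∘ galoisSurjOf_B(g) = galoisSurjOf_A(c g c⁻¹) ∘ b` for all `g`; and `galoisSurjOf_not_strict`-type
  remarks are left to the docstrings (the inner `c` is the discrepancy of base points, unavoidable).

So any `BiKummerSetting` whose Galois data are `(IsGaloisObj, galoisSurjOf)` on `B^temp(Π^tp_X)` — in
particular abc-iut-L2-t9's `mkOfModelCanonical` fed with them — satisfies the law, and abc-iut-L2-t3's planned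
field `galoisSurj_natural` is instantiated by `galoisSurjOf_natural` (one line).  Plain topological group
theory over the L3 vocabulary; a MODEL file (definitions = the model data, not cone definitions of [EtTh]);
nothing of [EtTh] is asserted; nothing here bears on [IUTchIII] Cor. 3.12.
-/

noncomputable section

open CategoryTheory Topology

namespace Literature.AnabelianGeometry.SemiGraphs

namespace GaloisObjects

open Literature.AlgebraicGeometry.Frobenioids (IsConnectedObj)
open Literature.AlgebraicGeometry.Frobenioids.QuasiTemperoid.BTempConnected

universe u

variable {G : Type u} [Group G] [TopologicalSpace G] [IsTopologicalGroup G] (hG : IsTempered G)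

/-! ### Automorphisms in `B^temp(Π)`: composition law and determination by one point -/

omit [IsTopologicalGroup G] in
/-- In `Aut`, `(σ * τ).hom = τ.hom ≫ σ.hom` (apply `τ` first; Mathlib's composition law on `Aut`, recorded for
the automorphism groups `Aut_{B^temp(Π)}(−)` of [SemiAnbd] Rmk. 3.1.3). [cite: MochizukiSemiAnbd2006, Rmk 3.1.3 p.34] -/
theorem aut_mul_hom {X : BTemp G} (σ τ : Aut X) : (σ * τ).hom = τ.hom ≫ σ.hom := rfl

omit [IsTopologicalGroup G] in
/-- Two automorphisms of a CONNECTED object of `B^temp(Π)` that agree on one point are equal.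
[cite: MochizukiSemiAnbd2006, Rmk 3.1.3 p.34] -/
theorem aut_eq_of_apply_eq {X : BTemp G} (hX : IsConnectedObj X) (σ τ : Aut X) (x₀ : X.obj.V)
    (h : (σ.hom.hom.hom x₀ : X.obj.V) = τ.hom.hom.hom x₀) : σ = τ :=
  Iso.ext (hom_eq_of_apply_eq hX _ _ x₀ h)

/-! ### Right translations of `Π/N` and the canonical surjection `Π ↠ Aut(Π/N)` -/

section Quotient

variable (N : Subgroup G) [hN : N.Normal] (hNo : IsOpen (N : Set G))

/-- **The right translation `xN ↦ xcN` of `Π/N`** (an automorphism of the Galois object `Π/N` of `B^temp(Π)`,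
[SemiAnbd] Rmk 3.1.3), chosen from abc-iut-L3's `exists_aut_quotientObj`. [cite: MochizukiSemiAnbd2006, Rmk 3.1.3 p.34] -/
def quotientTranslation (c : G) : Aut (BTemp.quotientObj G hG N hNo) :=
  (exists_aut_quotientObj hG N hNo c).choose

/-- The right translation sends the base point `N` to `cN`. [cite: MochizukiSemiAnbd2006, Rmk 3.1.3 p.34] -/
theorem quotientTranslation_apply_one (c : G) :
    ((quotientTranslation hG N hNo c).hom.hom.hom ((1 : G) : G ⧸ N) : G ⧸ N) = (c : G ⧸ N) :=
  (exists_aut_quotientObj hG N hNo c).choose_spec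

/-- The right translation on an arbitrary point: `aN ↦ acN` (equivariance for the left action).
[cite: MochizukiSemiAnbd2006, Rmk 3.1.3 p.34] -/
theorem quotientTranslation_apply (c a : G) :
    ((quotientTranslation hG N hNo c).hom.hom.hom (a : G ⧸ N) : G ⧸ N) = ((a * c : G) : G ⧸ N) := by
  rw [← quotientObj_ρ_one hG N hNo a, hom_ρ, quotientTranslation_apply_one, quotientObj_ρ_mk]

/-- **The canonical homomorphism `Π → Aut_{B^temp(Π)}(Π/N)`, `g ↦ (xN ↦ x g⁻¹ N)`** — a representative of the
"natural surjective outer homomorphism" of [EtTh] Def. 4.1 (ii) at the Galois object `Π/N` (the inverse makes it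
a homomorphism for the composition law of `Aut`). [cite: MochizukiEtTh2009, Def 4.1 p.313 (PDF p.87)] -/
def quotientGaloisSurj : G →* Aut (BTemp.quotientObj G hG N hNo) where
  toFun g := quotientTranslation hG N hNo g⁻¹
  map_one' := by
    refine aut_eq_of_apply_eq (isConnectedObj_quotientObj hG N hNo) _ _ ((1 : G) : G ⧸ N) ?_
    rw [quotientTranslation_apply_one, inv_one]
    rfl
  map_mul' g h := by
    refine aut_eq_of_apply_eq (isConnectedObj_quotientObj hG N hNo) _ _ ((1 : G) : G ⧸ N) ?_
    rw [quotientTranslation_apply_one, aut_mul_hom, comp_apply, quotientTranslation_apply_one,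
      quotientTranslation_apply, mul_inv_rev]

/-- The canonical homomorphism on points: `(quotientGaloisSurj g)(aN) = a g⁻¹ N`. [cite: MochizukiEtTh2009, Def 4.1 p.313 (PDF p.87)] -/
theorem quotientGaloisSurj_apply (g a : G) :
    ((quotientGaloisSurj hG N hNo g).hom.hom.hom (a : G ⧸ N) : G ⧸ N) = ((a * g⁻¹ : G) : G ⧸ N) :=
  quotientTranslation_apply hG N hNo g⁻¹ a

end Quotient

/-! ### Galois objects: chosen presentation `A ≅ Π/N_A`, base point, and the Galois surjection -/

section Galois

variable (A : BTemp G) (hA : IsGaloisObj A)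

/-- The open normal subgroup `N_A` of a chosen presentation `A ≅ Π/N_A` of the Galois object `A`
([SemiAnbd] Rmk 3.1.3, abc-iut-L3's `exists_iso_quotientObj_of_isGaloisObj`). [cite: MochizukiSemiAnbd2006, Rmk 3.1.3 p.34] -/
def galoisQuot : OpenNormalSubgroup G := (exists_iso_quotientObj_of_isGaloisObj hG A hA).choose

/-- The chosen isomorphism `A ≅ Π/N_A`. [cite: MochizukiSemiAnbd2006, Rmk 3.1.3 p.34] -/
def galoisIso : A ≅ BTemp.quotientObj G hG (galoisQuot hG A hA).toSubgroup (galoisQuot hG A hA).isOpen' :=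
  Classical.choice (exists_iso_quotientObj_of_isGaloisObj hG A hA).choose_spec

/-- The base point `x_A := e⁻¹(N_A)` of the Galois object `A` for the chosen presentation `e : A ≅ Π/N_A`.
[cite: MochizukiSemiAnbd2006, Rmk 3.1.3 p.34] -/
def galoisBase : A.obj.V :=
  (galoisIso hG A hA).inv.hom.hom ((1 : G) : G ⧸ (galoisQuot hG A hA).toSubgroup)

/-- **[EtTh] Def. 4.1 (ii) at the temperoid: the Galois surjection `Π → Aut_{B^temp(Π)}(A)`** of the Galois
object `A` — the canonical `Π → Aut(Π/N_A)` transported along the chosen `A ≅ Π/N_A` (changing the presentation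
changes it by an INNER automorphism of `Π`: the homomorphism is canonical as an OUTER homomorphism only).
[cite: MochizukiEtTh2009, Def 4.1 p.313 (PDF p.87)] -/
def galoisSurjOf : G →* Aut A :=
  haveI : (galoisQuot hG A hA).toSubgroup.Normal := inferInstance
  ((galoisIso hG A hA).symm.conjAut).toMonoidHom.comp
    (quotientGaloisSurj hG (galoisQuot hG A hA).toSubgroup (galoisQuot hG A hA).isOpen')

/-- **The Galois surjection on the base point: `galoisSurjOf_A(g)(x_A) = g⁻¹ · x_A`.**
[cite: MochizukiEtTh2009, Def 4.1 p.313 (PDF p.87)] -/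
theorem galoisSurjOf_apply_base (g : G) :
    ((galoisSurjOf hG A hA g).hom.hom.hom (galoisBase hG A hA) : A.obj.V) = A.obj.ρ g⁻¹ (galoisBase hG A hA) := by
  haveI : (galoisQuot hG A hA).toSubgroup.Normal := inferInstance
  change (((galoisIso hG A hA).symm.conjAut
      (quotientGaloisSurj hG (galoisQuot hG A hA).toSubgroup (galoisQuot hG A hA).isOpen' g)).hom.hom.hom
        (galoisBase hG A hA) : A.obj.V) = _
  rw [Iso.conjAut_hom, Iso.conj_apply, Iso.symm_inv, Iso.symm_hom, galoisBase, comp_apply, comp_apply,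
    iso_hom_inv_apply, quotientGaloisSurj_apply, one_mul, ← quotientObj_ρ_one hG _ _ g⁻¹, hom_ρ]

/-- The Galois surjection on an arbitrary point written through the base point: `galoisSurjOf_A(g)(a · x_A) =
(a g⁻¹) · x_A`. [cite: MochizukiEtTh2009, Def 4.1 p.313 (PDF p.87)] -/
theorem galoisSurjOf_apply (g a : G) :
    ((galoisSurjOf hG A hA g).hom.hom.hom (A.obj.ρ a (galoisBase hG A hA)) : A.obj.V) =
      A.obj.ρ (a * g⁻¹) (galoisBase hG A hA) := by
  rw [hom_ρ, galoisSurjOf_apply_base, ← ρ_mul_apply]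

/-- Every point of the Galois (hence connected) object `A` is a translate of the base point.
[cite: MochizukiSemiAnbd2006, Rmk 3.1.3 p.34] -/
theorem exists_ρ_galoisBase_eq (x : A.obj.V) : ∃ a : G, A.obj.ρ a (galoisBase hG A hA) = x :=
  ((isConnectedObj_iff A).mp hA.1).2 (galoisBase hG A hA) x

/-- **Def. 4.1 (ii) "surjective"** at the temperoid: every automorphism of the Galois object `A` is a
`galoisSurjOf_A(g)` ([SemiAnbd] Rmk 3.1.3: `Aut(Π/N) = Π/N` by right translations). [cite: MochizukiEtTh2009, Def 4.1 p.313 (PDF p.87)] -/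
theorem galoisSurjOf_surjective : Function.Surjective (galoisSurjOf hG A hA) := by
  intro σ
  obtain ⟨a, ha⟩ := exists_ρ_galoisBase_eq hG A hA (σ.hom.hom.hom (galoisBase hG A hA))
  refine ⟨a⁻¹, aut_eq_of_apply_eq hA.1 _ _ (galoisBase hG A hA) ?_⟩
  rw [galoisSurjOf_apply_base, inv_inv, ha]

/-- The kernel of the Galois surjection is the stabiliser of the base point. [cite: MochizukiEtTh2009, Def 4.1 p.313 (PDF p.87)] -/
theorem mem_ker_galoisSurjOf_iff (g : G) :
    g ∈ (galoisSurjOf hG A hA).ker ↔ A.obj.ρ g (galoisBase hG A hA) = galoisBase hG A hA := by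
  rw [MonoidHom.mem_ker]
  constructor
  · intro h
    have h1 := galoisSurjOf_apply_base hG A hA g
    rw [h] at h1
    change galoisBase hG A hA = _ at h1
    have h2 := congrArg (A.obj.ρ g) h1
    rw [ρ_apply_inv] at h2
    exact h2
  · intro h
    refine aut_eq_of_apply_eq hA.1 _ _ (galoisBase hG A hA) ?_
    rw [galoisSurjOf_apply_base]
    have h2 := congrArg (A.obj.ρ g⁻¹) h
    rw [ρ_inv_apply] at h2
    exact h2.symm

/-- **The kernel of the Galois surjection of `A ≅ Π/N_A` is `N_A`** (so `Π/N_A ≅ Aut(A)`; [SemiAnbd] Rmk 3.1.3).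
[cite: MochizukiEtTh2009, Def 4.1 p.313 (PDF p.87)] -/
theorem ker_galoisSurjOf : (galoisSurjOf hG A hA).ker = (galoisQuot hG A hA).toSubgroup := by
  ext g
  rw [mem_ker_galoisSurjOf_iff, galoisBase]
  constructor
  · intro h
    have h1 := congrArg (fun x : A.obj.V => ((galoisIso hG A hA).hom.hom.hom x : G ⧸ (galoisQuot hG A hA).toSubgroup)) h
    simp only at h1
    rwa [hom_ρ, iso_hom_inv_apply, quotientObj_ρ_one_eq_iff] at h1
  · intro h
    rw [← hom_ρ, (quotientObj_ρ_one_eq_iff hG _ _ g).mpr h]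

/-- **The kernel of the Galois surjection is OPEN** (it is the open normal subgroup `N_A`): `galoisSurjOf_A` is a
continuous surjection onto the discrete group `Aut(A)`. [cite: MochizukiEtTh2009, Def 4.1 p.313 (PDF p.87)] -/
theorem isOpen_ker_galoisSurjOf : IsOpen ((galoisSurjOf hG A hA).ker : Set G) := by
  rw [ker_galoisSurjOf]
  exact (galoisQuot hG A hA).isOpen'

/-! ### The naturality law of [EtTh] Def. 4.1 (ii) ("natural … outer homomorphism") at the temperoid -/

/-- **[EtTh] Def. 4.1 (ii) — NATURALITY of the Galois surjections UP TO INNER AUTOMORPHISM, PROVED at the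
temperoid `B^temp(Π)`** (the law carried as the hypothesis binder `hS` of
`EtaleTheta/Discharge/Sec4GaloisSurjNatural.lean`, in EXACTLY that shape): for every morphism `b : B → A`
between Galois objects there is `c ∈ Π` — the discrepancy `b(x_B) = c⁻¹ · x_A` of the chosen base points — with
`b ∘ galoisSurjOf_B(g) = galoisSurjOf_A(c g c⁻¹) ∘ b` for all `g ∈ Π`.  (STRICT naturality, `c = 1` for all
`b`, is false as soon as some `Π/N_A` is non-abelian: precomposing `b` with a right translation of `B` changes
`c` by the translating element.) [cite: MochizukiEtTh2009, Def 4.1 p.313 (PDF p.87)] -/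
theorem galoisSurjOf_natural ⦃A B : BTemp G⦄ (hA : IsGaloisObj A) (hB : IsGaloisObj B) (b : B ⟶ A) :
    ∃ c : G, ∀ g : G,
      (galoisSurjOf hG B hB g).hom ≫ b = b ≫ (galoisSurjOf hG A hA (c * g * c⁻¹)).hom := by
  obtain ⟨a, ha⟩ := exists_ρ_galoisBase_eq hG A hA (b.hom.hom (galoisBase hG B hB))
  refine ⟨a⁻¹, fun g => hom_eq_of_apply_eq hB.1 _ _ (galoisBase hG B hB) ?_⟩
  rw [comp_apply, comp_apply, galoisSurjOf_apply_base, hom_ρ, ← ha, galoisSurjOf_apply, ← ρ_mul_apply,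
    show a * (a⁻¹ * g * a⁻¹⁻¹)⁻¹ = g⁻¹ * a by group]

/-- **Conjugation-compatibility** (abc-iut-L2-t3's first law, `galoisSurj_conj`) at the temperoid: for
`σ ∈ Aut(A)` there is `c ∈ Π` with `σ ∘ galoisSurjOf_A(g) ∘ σ⁻¹ = galoisSurjOf_A(c g c⁻¹)` — here a special case
of naturality (`b := σ⁻¹`), and in general a consequence of surjectivity alone (`Sec4GaloisSurjNatural`).
[cite: MochizukiEtTh2009, Def 4.1 p.313 (PDF p.87)] -/
theorem galoisSurjOf_conj (A : BTemp G) (hA : IsGaloisObj A) (σ : Aut A) :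
    ∃ c : G, ∀ g : G, σ * galoisSurjOf hG A hA g * σ⁻¹ = galoisSurjOf hG A hA (c * g * c⁻¹) := by
  obtain ⟨c, hc⟩ := galoisSurjOf_surjective hG A hA σ
  refine ⟨c, fun g => ?_⟩
  rw [← hc, ← map_inv, ← map_mul, ← map_mul]

end Galois

/-! ### The law holds for the canonical model setting fed with the temperoid's Galois data -/

section Canonical

open Literature.AlgebraicGeometry.Frobenioids Literature.AnabelianGeometry.EtaleTheta

universe u₀ v₀ w

variable {K : Type u₀} [Field K] (X : TemperedArithmeticGroup.{u₀} K) {D₀ : Type u₀} [Category.{v₀} D₀]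
  {V : FrdIMonoidStub.{w}}
  {T : RealifiedDivisorMonoids (D₀ := D₀) V}
  {VD : FrdICatStub.{u₀ + 1, u₀, w} (BTemp X.Pi)}
  (tf : TemperedFrobenioid T (BTemp X.Pi) VD) (hZ : tf.monoidType = MonoidType.Z)
  (hP : ∀ A : (BTemp X.Pi)ᵒᵖ, IsPerfect (tf.Φ.carrier A))
  (NH : Subgroup (Field.absoluteGaloisGroup K) → tf.category → ℕ+ → Prop) (A₀ : tf.category)
  (hA₀ : PreFrobenioid.IsFrobeniusTrivial tf.toElem A₀)
  (hA₀' : IsGaloisObj A₀.base)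

/-- **abc-iut-L2-t3's planned field `galoisSurj_natural` is a ONE-LINE INSTANCE at the canonical model**: for a
tempered Frobenioid `tf` over the genuine base `D := B^temp(Π^tp_X)` and abc-iut-L2-t9's
`BiKummerSetting.mkOfModelCanonical` fed with the temperoid's Galois data `(IsGaloisObj, galoisSurjOf)`, the
naturality law of `Sec4GaloisSurjNatural` (binder `hS` there) HOLDS — by `galoisSurjOf_natural`.
[cite: MochizukiEtTh2009, Def 4.1 p.313 (PDF p.87)] -/
theorem mkOfModelCanonical_galoisSurj_natural :
    ∀ ⦃A B : BTemp X.Pi⦄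
      (hA : (BiKummerSetting.mkOfModelCanonical X tf hZ hP IsGaloisObj
          (fun A h => galoisSurjOf X.isTempered A h) (fun A h => galoisSurjOf_surjective X.isTempered A h)
          NH A₀ hA₀ hA₀').IsGaloisObj A)
      (hB : (BiKummerSetting.mkOfModelCanonical X tf hZ hP IsGaloisObj
          (fun A h => galoisSurjOf X.isTempered A h) (fun A h => galoisSurjOf_surjective X.isTempered A h)
          NH A₀ hA₀ hA₀').IsGaloisObj B)
      (b : B ⟶ A), ∃ c : X.Pi, ∀ g : X.Pi,
        ((BiKummerSetting.mkOfModelCanonical X tf hZ hP IsGaloisObj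
            (fun A h => galoisSurjOf X.isTempered A h) (fun A h => galoisSurjOf_surjective X.isTempered A h)
            NH A₀ hA₀ hA₀').galoisSurj B hB g).hom ≫ b =
          b ≫ ((BiKummerSetting.mkOfModelCanonical X tf hZ hP IsGaloisObj
            (fun A h => galoisSurjOf X.isTempered A h) (fun A h => galoisSurjOf_surjective X.isTempered A h)
            NH A₀ hA₀ hA₀').galoisSurj A hA (c * g * c⁻¹)).hom :=
  galoisSurjOf_natural X.isTempered

/-- Likewise the surjection of the canonical model setting at a Galois object has OPEN kernel (needed nowhere
in §4 as typed, recorded for abc-iut-L2-t3's optional field). [cite: MochizukiEtTh2009, Def 4.1 p.313 (PDF p.87)] -/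
theorem mkOfModelCanonical_isOpen_ker_galoisSurj (A : BTemp X.Pi)
    (hA : (BiKummerSetting.mkOfModelCanonical X tf hZ hP IsGaloisObj
        (fun A h => galoisSurjOf X.isTempered A h) (fun A h => galoisSurjOf_surjective X.isTempered A h)
        NH A₀ hA₀ hA₀').IsGaloisObj A) :
    IsOpen (((BiKummerSetting.mkOfModelCanonical X tf hZ hP IsGaloisObj
        (fun A h => galoisSurjOf X.isTempered A h) (fun A h => galoisSurjOf_surjective X.isTempered A h)
        NH A₀ hA₀ hA₀').galoisSurj A hA).ker : Set X.Pi) :=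
  isOpen_ker_galoisSurjOf X.isTempered A hA

end Canonical

end GaloisObjects

end Literature.AnabelianGeometry.SemiGraphs

end
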